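import Literature.Analysis.FluidPDE.FluidComputer.VorticityForm
import Literature.Analysis.FluidPDE.FluidComputer.GalerkinExistence
import Summits.NavierStokesRegularity.FluidComputer.ModeBirth
import HarnessLib

/-!
# The gadget → engine hand-off `W ↦ û = i k × Ŵ/|k|²` is solenoidal for EVERY input, returns the Leray projection of `W` as vorticity, drops the mean, and its energy / enstrophy are those of the solenoidal part of `W`

PLACEMENT: cell-own elementary lemmas of `pub-fluidc` (topic `FluidComputer` under the host summit, per
the hub's 2026-08-19 placement rule: new work under `Summits/<Summit>/<topic>/`, `Literature/` only for
cited published results); the vocabulary (`FourierVelocity`, `kcross`, `leray`, `curl`, `biotSavart`,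
`modalEnergy`, `truncEnergy`, `truncEnstrophy`) is the Literature one, opened below.

HONEST FRAMING (cell `pub-fluidc`, verbatim): *low prior, high value-of-information experiment on
Tao's machine paradigm; NOT a claim that NS blows up.* The object is the lattice algebra of Fourier
coefficients on `ℤ³`; nothing is said about the Navier–Stokes PDE, no time stepping, no floating point.

WHAT IS TYPED. The gadget library of the cell (HOME/code/gadgets, paper §G.2 'EXACT SOLENOIDALITY')
builds, for its filament families, the Fourier coefficients `W(k) ∈ ℂ³` of a sampled real vorticity-like
field (exact Gaussian-tube coefficients; solenoidal only up to the recorded `engine.vorticity_div_defect`,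
and possibly with a net box component `W(0)`, which 'a periodic field cannot carry' and the library drops
with a flag) and hands the engines the velocity `û(k) = i k × W(k)/|k|²` — the lattice Biot–Savart map
`VorticityForm.biotSavart` of the Literature, where it is shown to invert `curl` ON DIVERGENCE-FREE inputs
(`biotSavart_curl`, `curl_biotSavart`). This file records what the map does to an ARBITRARY input, which
is what the paper's sentence 'so ∇·u vanishes to rounding by construction, not by projection of a
non-solenoidal guess' and the library's own source comments ('Biot–Savart ignores the gradient part')
assert:

* `kdot_biotSavart` — **`k · BS_k(w) = 0` for every `w`**: the handed-over velocity is solenoidal BY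
  CONSTRUCTION (it is `k ×` something; `EnergyParseval.kdot_kcross`), whatever the input;
* `biotSavart_smul_self`, `biotSavart_add`, `biotSavart_leray` — `BS_k` kills gradient parts `c k`, is
  additive, hence **`BS_k(P_k w) = BS_k(w)`**: only the solenoidal (Leray) part of the input is seen;
* `curl_biotSavart_eq_leray` — **`i k × BS_k(w) = P_k w`** (`k ≠ 0`, ANY `w`): the vorticity the engine
  actually carries is the Leray projection of the library's field — the general form of the Literature's
  `curl_biotSavart` (which assumes `k · w = 0`);
* `biotSavart_zero_left` — `BS_0 = 0`: a net box component of the input is dropped, the velocity has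
  zero mean;
* `ofVorticity` — for ANY coefficient family with the reality symmetry `W(-k) = conj W(k)` (the DFT of a
  real field) the hand-off IS a `FourierVelocity` (real and divergence-free), with
  `curl_ofVorticity_coeff` (`ω̂(k) = P_k W(k)`, `k ≠ 0`), `curl_ofVorticity_coeff_of_kdot` (`= W(k)` when
  `k · W(k) = 0`), `curl_ofVorticity_coeff_zero` (`ω̂(0) = 0`);
* the t = 0 BOOKKEEPING, exactly: `normSq_leray_sum` — **Pythagoras `Σ_j |P_k w_j|² = Σ_j |w_j|² −
  |k · w|²/|k|²`** (the deficit is the gradient part, i.e. the divergence of the input at that mode);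
  `normSq_biotSavart_sum` — `|BS_k(w)|² = |P_k w|²/|k|²`; hence `modalEnergy_ofVorticity`
  (`E(k) = ½|P_k W(k)|²/|k|²`), `knormSq_mul_modalEnergy_ofVorticity` (modal enstrophy of `û` = energy
  of the solenoidal part of `W(k)`), `modalEnergy_ofVorticity_le` (`E(k) ≤ ½|W(k)|²/|k|²`, equality iff
  `k · W(k) = 0`: `modalEnergy_ofVorticity_of_kdot`), and on any mask `S ∌ 0`:
  `truncEnstrophy_ofVorticity` — **`Z_S(û) = ½ Σ_{k∈S} |W(k)|² − ½ Σ_{k∈S} |k · W(k)|²/|k|²`**, so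
  `truncEnstrophy_ofVorticity_le` — the engine's initial enstrophy is the library's nominal `½‖W‖²_S`
  minus its divergence spectrum, never more (for the release suite's `vorticity_div_defect` of order
  1e-17 the two agree to rounding; the typed statement is what makes that number the right one to log).

All statements are identities of the lattice vector algebra [folklore]; `re_cdot_conj_leray`
(`ModeBirth`) supplies `Σ|P_k w|² = Re⟨P_k w, w⟩`. No named facts (D-0026); 0 sorry.
-/

noncomputable section

namespace Summit.NavierStokesRegularity.FluidComputer

open Complex ComplexConjugate Finset
open scoped BigOperators
open Literature.Analysis.FluidPDE.FluidComputer
open Literature.Analysis.FluidPDE.FluidComputer.ShellTransfer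
open Literature.Analysis.FluidPDE.FluidComputer.ShellTransfer.GalerkinODE

namespace BiotSavartHandoff

/-! ## The Biot–Savart map on an arbitrary input -/

/-- **`k · BS_k(w) = 0` for every `w ∈ ℂ³`**: the Biot–Savart velocity is solenoidal by construction,
with no hypothesis on the input (`k · (k × w) = 0`). [folklore] -/
theorem kdot_biotSavart (k : Fin 3 → ℤ) (w : Fin 3 → ℂ) : kdot k (biotSavart k w) = 0 := by
  have e : biotSavart k w = fun j => (I / (knormSq k : ℂ)) * kcross k w j := by
    funext j; unfold biotSavart; ring
  rw [e, kdot_const_mul, kdot_kcross, mul_zero]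

/-- `BS_k(c k) = 0`: a gradient part of the input is invisible to Biot–Savart (`k × k = 0`). [folklore] -/
theorem biotSavart_smul_self (k : Fin 3 → ℤ) (c : ℂ) :
    biotSavart k (fun j => c * ((k j : ℤ) : ℂ)) = 0 := by
  funext j
  unfold biotSavart
  rw [kcross_smul_self]
  simp

/-- `BS_k` is additive. [folklore] -/
theorem biotSavart_add (k : Fin 3 → ℤ) (a b : Fin 3 → ℂ) :
    biotSavart k (fun j => a j + b j) = fun j => biotSavart k a j + biotSavart k b j := by
  funext j
  simp only [biotSavart, kcross_add]
  ring

/-- `BS_0 = 0`: the `k = 0` (net box) component of the input is dropped; the velocity has zero mean.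
[folklore] -/
theorem biotSavart_zero_left (w : Fin 3 → ℂ) : biotSavart 0 w = 0 := by
  funext j
  have h0 : knormSq 0 = 0 := (knormSq_eq_zero_iff 0).mpr rfl
  simp [biotSavart, h0]

/-- **`BS_k(P_k w) = BS_k(w)`**: Biot–Savart only sees the solenoidal (Leray) part of its input. [folklore] -/
theorem biotSavart_leray (k : Fin 3 → ℤ) (w : Fin 3 → ℂ) : biotSavart k (leray k w) = biotSavart k w := by
  have e : leray k w = fun j => w j + (-(kdot k w / (knormSq k : ℂ))) * ((k j : ℤ) : ℂ) := by
    funext j; rw [leray_apply]; ring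
  rw [e, biotSavart_add, biotSavart_smul_self]
  funext j
  simp

/-- **`i k × BS_k(w) = P_k w`** for `k ≠ 0` and ANY `w`: the curl of the Biot–Savart velocity is the Leray
projection of the input (the general form of `VorticityForm.curl_biotSavart`, which assumes `k · w = 0`).
[folklore] -/
theorem curl_biotSavart_eq_leray {k : Fin 3 → ℤ} (hk : knormSq k ≠ 0) (w : Fin 3 → ℂ) (j : Fin 3) :
    I * kcross k (biotSavart k w) j = leray k w j := by
  rw [← biotSavart_leray]
  exact curl_biotSavart hk (kdot_leray k w) j

/-! ## Exact bookkeeping: Pythagoras for the Leray projection, energy of the Biot–Savart velocity -/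

/-- **Pythagoras for `P_k`**: `Σ_j |(P_k w)_j|² = Σ_j |w_j|² − |k · w|²/|k|²` — the deficit is exactly the
gradient part of `w` (its 'divergence' at the mode `k`). Holds for `k = 0` too (`P_0 = id`, `0/0 = 0`).
[folklore] -/
theorem normSq_leray_sum (k : Fin 3 → ℤ) (w : Fin 3 → ℂ) :
    ∑ j, Complex.normSq (leray k w j)
      = ∑ j, Complex.normSq (w j) - Complex.normSq (kdot k w) / knormSq k := by
  rw [← ModeBirth.re_cdot_conj_leray k w]
  unfold cdot
  have e : ∀ j, conj (leray k w j) * w j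
      = conj (w j) * w j - conj (kdot k w / (knormSq k : ℂ)) * (((k j : ℤ) : ℂ) * w j) := fun j => by
    rw [leray_apply, map_sub, map_mul, map_intCast]; ring
  simp_rw [e, Finset.sum_sub_distrib, ← Finset.mul_sum]
  have hD : ∑ j, ((k j : ℤ) : ℂ) * w j = kdot k w := rfl
  rw [hD, map_div₀, Complex.conj_ofReal, Complex.sub_re, Complex.re_sum]
  have h1 : ∀ j, (conj (w j) * w j).re = Complex.normSq (w j) := fun j => by
    rw [← Complex.normSq_eq_conj_mul_self, Complex.ofReal_re]
  have h2 : (conj (kdot k w) / (knormSq k : ℂ) * kdot k w).re = Complex.normSq (kdot k w) / knormSq k := by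
    rw [div_mul_eq_mul_div, ← Complex.normSq_eq_conj_mul_self, ← Complex.ofReal_div, Complex.ofReal_re]
  simp_rw [h1, h2]

/-- `Σ_j |(P_k w)_j|² ≤ Σ_j |w_j|²`. [folklore] -/
theorem normSq_leray_sum_le (k : Fin 3 → ℤ) (w : Fin 3 → ℂ) :
    ∑ j, Complex.normSq (leray k w j) ≤ ∑ j, Complex.normSq (w j) := by
  rw [normSq_leray_sum]
  exact sub_le_self _ (div_nonneg (Complex.normSq_nonneg _) (knormSq_nonneg k))

/-- **`|BS_k(w)|² = |P_k w|²/|k|²`** (for `k = 0` both sides vanish). [folklore] -/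
theorem normSq_biotSavart_sum (k : Fin 3 → ℤ) (w : Fin 3 → ℂ) :
    ∑ j, Complex.normSq (biotSavart k w j) = (∑ j, Complex.normSq (leray k w j)) / knormSq k := by
  by_cases hk : knormSq k = 0
  · have hz : k = 0 := (knormSq_eq_zero_iff k).mp hk
    subst hz
    simp [biotSavart_zero_left, hk]
  · rw [← biotSavart_leray]
    have hdiv : kdot k (leray k w) = 0 := kdot_leray k w
    have e : ∀ j, Complex.normSq (biotSavart k (leray k w) j)
        = Complex.normSq (kcross k (leray k w) j) / (knormSq k * knormSq k) := fun j => by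
      unfold biotSavart
      rw [map_div₀, map_mul, Complex.normSq_I, one_mul, Complex.normSq_ofReal]
    simp_rw [e]
    rw [← Finset.sum_div, normSq_kcross_sum k (leray k w) hdiv, mul_div_mul_left _ _ hk]

/-! ## The hand-off as a `FourierVelocity` -/

/-- **The hand-off.** For ANY lattice coefficient family `W : ℤ³ → ℂ³` with the reality symmetry
`W(-k)_j = conj W(k)_j` (the DFT of a real vector field — not assumed solenoidal, not assumed mean-free),
`k ↦ BS_k(W(k)) = i k × W(k)/|k|²` is a `FourierVelocity`: real (`(-k) × conj w = -conj (k × w)`,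
`|−k|² = |k|²`, `conj i = −i`) and divergence-free (`kdot_biotSavart`). [folklore] -/
def ofVorticity (W : (Fin 3 → ℤ) → Fin 3 → ℂ) (hW : ∀ k j, W (-k) j = conj (W k j)) : FourierVelocity where
  coeff k := biotSavart k (W k)
  reality k j := by
    have hWk : W (-k) = fun i => conj (W k i) := funext (hW k)
    show biotSavart (-k) (W (-k)) j = conj (biotSavart k (W k) j)
    rw [hWk]
    unfold biotSavart
    rw [kcross_neg_conj, knormSq_neg', map_div₀, map_mul, Complex.conj_I, Complex.conj_ofReal]
    ring
  divFree k := by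
    have h := kdot_biotSavart k (W k)
    unfold kdot at h
    exact h

variable (W : (Fin 3 → ℤ) → Fin 3 → ℂ) (hW : ∀ k j, W (-k) j = conj (W k j))

/-- `û(k) = BS_k(W(k))`. [folklore] -/
@[simp] theorem ofVorticity_coeff (k : Fin 3 → ℤ) : (ofVorticity W hW).coeff k = biotSavart k (W k) := rfl

/-- `û(0) = 0`: zero mean flow, whatever `W(0)` is. [folklore] -/
theorem ofVorticity_coeff_zero : (ofVorticity W hW).coeff 0 = 0 := by
  rw [ofVorticity_coeff, biotSavart_zero_left]

/-- **`ω̂(k) = P_k W(k)`** for `k ≠ 0`: the vorticity of the handed-over field is the Leray projection of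
the library's field, mode by mode. [folklore] -/
theorem curl_ofVorticity_coeff {k : Fin 3 → ℤ} (hk : k ≠ 0) (j : Fin 3) :
    (curl (ofVorticity W hW)).coeff k j = leray k (W k) j := by
  rw [curl_coeff, ofVorticity_coeff]
  exact curl_biotSavart_eq_leray (fun h => hk ((knormSq_eq_zero_iff k).mp h)) (W k) j

/-- `ω̂(k) = W(k)` when `k ≠ 0` and `k · W(k) = 0`: a solenoidal input is returned exactly. [folklore] -/
theorem curl_ofVorticity_coeff_of_kdot {k : Fin 3 → ℤ} (hk : k ≠ 0) (hdiv : kdot k (W k) = 0) :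
    (curl (ofVorticity W hW)).coeff k = W k := by
  funext j
  rw [curl_ofVorticity_coeff W hW hk, leray_of_kdot_eq_zero hdiv]

/-- `ω̂(0) = 0`: a net box component `W(0)` of the input is dropped. [folklore] -/
theorem curl_ofVorticity_coeff_zero : (curl (ofVorticity W hW)).coeff 0 = 0 := by
  funext j
  rw [curl_coeff, ofVorticity_coeff_zero]
  fin_cases j <;> simp

/-- **`E(k) = ½ |P_k W(k)|²/|k|²`**: the modal energy of the hand-off is that of the solenoidal part of the
input. [folklore] -/
theorem modalEnergy_ofVorticity (k : Fin 3 → ℤ) :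
    modalEnergy (ofVorticity W hW) k = (1 / 2) * (∑ j, Complex.normSq (leray k (W k) j)) / knormSq k := by
  unfold modalEnergy
  rw [ofVorticity_coeff, normSq_biotSavart_sum]
  ring

/-- `E(k) = (½|W(k)|² − ½|k · W(k)|²/|k|²)/|k|²`, explicitly. [folklore] -/
theorem modalEnergy_ofVorticity_eq (k : Fin 3 → ℤ) :
    modalEnergy (ofVorticity W hW) k
      = ((1 / 2) * ∑ j, Complex.normSq (W k j)
          - (1 / 2) * (Complex.normSq (kdot k (W k)) / knormSq k)) / knormSq k := by
  rw [modalEnergy_ofVorticity, normSq_leray_sum]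
  ring

/-- `E(k) ≤ ½|W(k)|²/|k|²`. [folklore] -/
theorem modalEnergy_ofVorticity_le (k : Fin 3 → ℤ) :
    modalEnergy (ofVorticity W hW) k ≤ (1 / 2) * (∑ j, Complex.normSq (W k j)) / knormSq k := by
  rw [modalEnergy_ofVorticity]
  exact div_le_div_of_nonneg_right
    (mul_le_mul_of_nonneg_left (normSq_leray_sum_le k (W k)) (by norm_num)) (knormSq_nonneg k)

/-- `E(k) = ½|W(k)|²/|k|²` when `k · W(k) = 0`. [folklore] -/
theorem modalEnergy_ofVorticity_of_kdot {k : Fin 3 → ℤ} (hdiv : kdot k (W k) = 0) :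
    modalEnergy (ofVorticity W hW) k = (1 / 2) * (∑ j, Complex.normSq (W k j)) / knormSq k := by
  rw [modalEnergy_ofVorticity, leray_of_kdot_eq_zero hdiv]

/-- **Modal enstrophy of `û` = energy of the solenoidal part of `W(k)`**: `|k|² E(k) = ½|P_k W(k)|²`
(`k ≠ 0`). [folklore] -/
theorem knormSq_mul_modalEnergy_ofVorticity {k : Fin 3 → ℤ} (hk : k ≠ 0) :
    knormSq k * modalEnergy (ofVorticity W hW) k = (1 / 2) * ∑ j, Complex.normSq (leray k (W k) j) := by
  have hk' : knormSq k ≠ 0 := fun h => hk ((knormSq_eq_zero_iff k).mp h)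
  rw [modalEnergy_ofVorticity]
  field_simp

/-- **`Z_S(û) = ½ Σ_{k∈S} |W(k)|² − ½ Σ_{k∈S} |k · W(k)|²/|k|²`** on any mask `S ∌ 0`: the engine's initial
enstrophy is the library's nominal `½‖W‖²_S` minus the divergence spectrum of `W`. [folklore] -/
theorem truncEnstrophy_ofVorticity (S : Finset (Fin 3 → ℤ)) (h0 : (0 : Fin 3 → ℤ) ∉ S) :
    truncEnstrophy (ofVorticity W hW) S
      = (1 / 2) * ∑ k ∈ S, ∑ j, Complex.normSq (W k j)
          - (1 / 2) * ∑ k ∈ S, Complex.normSq (kdot k (W k)) / knormSq k := by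
  unfold truncEnstrophy
  rw [Finset.mul_sum, Finset.mul_sum, ← Finset.sum_sub_distrib]
  refine Finset.sum_congr rfl fun k hk => ?_
  have hkne : k ≠ 0 := fun h => h0 (h ▸ hk)
  rw [knormSq_mul_modalEnergy_ofVorticity W hW hkne, normSq_leray_sum]
  ring

/-- `Z_S(û) ≤ ½ Σ_{k∈S} |W(k)|²` (`S ∌ 0`), with equality iff `W` is solenoidal on `S`. [folklore] -/
theorem truncEnstrophy_ofVorticity_le (S : Finset (Fin 3 → ℤ)) (h0 : (0 : Fin 3 → ℤ) ∉ S) :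
    truncEnstrophy (ofVorticity W hW) S ≤ (1 / 2) * ∑ k ∈ S, ∑ j, Complex.normSq (W k j) := by
  rw [truncEnstrophy_ofVorticity W hW S h0]
  have : 0 ≤ ∑ k ∈ S, Complex.normSq (kdot k (W k)) / knormSq k :=
    Finset.sum_nonneg fun k _ => div_nonneg (Complex.normSq_nonneg _) (knormSq_nonneg k)
  linarith

/-- `Z_S(û) = ½ Σ_{k∈S} |W(k)|²` when `W` is solenoidal on `S ∌ 0`. [folklore] -/
theorem truncEnstrophy_ofVorticity_of_kdot (S : Finset (Fin 3 → ℤ)) (h0 : (0 : Fin 3 → ℤ) ∉ S)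
    (hdiv : ∀ k ∈ S, kdot k (W k) = 0) :
    truncEnstrophy (ofVorticity W hW) S = (1 / 2) * ∑ k ∈ S, ∑ j, Complex.normSq (W k j) := by
  rw [truncEnstrophy_ofVorticity W hW S h0]
  have : ∑ k ∈ S, Complex.normSq (kdot k (W k)) / knormSq k = 0 :=
    Finset.sum_eq_zero fun k hk => by rw [hdiv k hk, map_zero, zero_div]
  rw [this, mul_zero, sub_zero]

/-- **`E_S(û) = Σ_{k∈S} ½|P_k W(k)|²/|k|²`**: the truncated energy of the hand-off. [folklore] -/
theorem truncEnergy_ofVorticity (S : Finset (Fin 3 → ℤ)) :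
    truncEnergy (ofVorticity W hW) S
      = ∑ k ∈ S, (1 / 2) * (∑ j, Complex.normSq (leray k (W k) j)) / knormSq k := by
  unfold truncEnergy
  exact Finset.sum_congr rfl fun k _ => modalEnergy_ofVorticity W hW k

end BiotSavartHandoff

end Summit.NavierStokesRegularity.FluidComputer

end
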